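import Summits.CriticalPhenomena.PercolationContinuityZ3.Theorems.Transplant.GrigorchukWitnessSlabWindow
import HarnessLib

/-!
# The W2 height axis — THE TWO-SLAB DOUBLING INEQUALITY `(1 − ψ_R(L))·F(2L+1) ≤ (1 − ψ_R(L) + ψ_T(L))·F(L)` (CARD-7's first lemma, KERNEL)

Proof file (`--supports stmt-CriticalPhenomena-4575 --as helper`, kind proof, def-free), lane `prim-bschramm`, seat `prim-bschramm-stmt` gen 42 (stmt port pen);
the T-DOUBLING item (lead g29 RULING T-DOUBLING-2 #9926 / #9961 «deferred, not killed»; design desk p3 g42 shape word #9917 (D1)–(D6), division-free;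
w-ideation round 3: CARD-7 «boundary-flux-ratio-doubling» by w-idea-2 g7 (Sketch-CARD-7.lean 3a66c724 / 7adc5d7e, ONE sorry = `doubling_le`), graded PASS +
typable as a REDUCTION by the critic w-crit-1 g2 #9919; the division-free interface algebra of §5 is w-idea-2 g7's (Sketch §2b, proved there), copied with
attribution).  Over «GrigorchukWitnessSlabWindow» (the window lemma (W) + slab geometry + transport).  builds on p205010 (kernel theorem, internal audit signed;
external expert review pending) — nothing here uses p205010.  No instance, no notation, no sorry, no def; standard axioms; default heartbeats.

THE MECHANISM (CARD-7; every object in the tree's slab vocabulary `slabSet`, `gzCay.induce`, `expClusterSize`, `criticalProbIOf`, `openConnIn`).  Stack two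
`L`-slabs: `S = 𝔊 × [0, 2L+1] = S₁ ∪ S₂`, `S₁ = 𝔊 × [0, L]`, `S₂ = 𝔊 × [L+1, 2L+1]`, root `o = (1, 0)`, `p = p_c(Cay(𝔊 × ℤ))` (one number, read at `o`).
With `M₁, M₂` the expected numbers of vertices of the interface layers `L`, `L+1` in the `S`-cluster of `o`, `F = F(L) = E|C^{S₁}(o)|` (the boundary-root
susceptibility of an `L`-slab, `boundary_eq_canonical`), `R = Σ'_{g'} P(o ↔ (g', 0) in S₁)` (same-face mass) and `T = Σ'_{g'} P(o ↔ (g', L) in S₁)` (through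
mass), the WINDOW LEMMA applied FROM THE TARGET'S SIDE at each vertex of a half-slab or of an interface layer, its exits located by §2 of the window file and its
start sums evaluated by left-invariance / reflection / shift (§3 there), gives the closed system
  (D1) `mass(S₂) ≤ p·F·M₁`,  (D2) `mass(S₁) ≤ F + p·F·M₂`,  (D3) `M₁ ≤ T + p·R·M₂`,  (D4) `M₂ ≤ p·R·M₁`
(`upperHalf_mass_le`, `lowerHalf_mass_le`, `interface_lower_le`, `interface_upper_le`), and with `E|C^S(o)| ≤ mass(S₁) + mass(S₂)`, `M₁ < ∞` (T7) and the
division-free solve `(1 − pR)(M₁ + M₂) ≤ T` (`interface_solve`):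
  **`doubling_le (L) : (1 − p·R(L)) · F(2L+1) ≤ (1 − p·R(L) + p·T(L)) · F(L)`** in `ℝ≥0∞`, with `R(L)`, `T(L)` LITERALLY the two series of F3's `layer_flux_ge 0 L 0`
(same-face mass of the bottom root; through mass from the top root) — i.e. Sketch-CARD-7's `doubling_le` with its abbreviations `F / psiR / psiT / pcE` unfolded;
truncated subtraction makes it `0 ≤ …` when `p·R(L) ≥ 1`, and `F(2L+1) ≤ F(L)·(1 + Θ(L))`, `Θ = p·T/(1 − p·R)`, otherwise.  Mean field: every line an identity.
The kernel floor `1 ≤ p·T(L) + p·R(L)` (F3) is recorded next to it (`one_le_flux_boundary`), so «`Θ ≥ 1`» is on file.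
HONEST STATUS: a REDUCTION STEP on the height axis, not progress on FLUX(W2) — its useful regime `p·R(L) < 1` (K2) is the near-tightness of the flux floor at
boundary roots (critic V7-1) and is a LOCATED NEGATIVE on every lattice control `ℤ^{d−1} × [0, L]`, `d = 2…7` (refuter p5-g35 kit j328362, VERDICTS :568; class
C, not used here); on W2 it is undecided (A3 pending).  NOTHING here claims FLUX(W2), K3′, K3″, `θ(p_c) = 0` on W2 (`gzCay_conj4` OPEN), or anything about
the residue node / `…conj4_endState`.  The doors `RatioBounded → SlabSusceptPolySeq` etc. are NOT typed here (HELD, R-T5-1).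
[cite: DuminilCopinTassionCMP2016, Lemma 1.5 and Thm. 1.1 (φ_p(S))] [cite: BenjaminiSchramm1996, §2 (Cayley graphs; 𝔊 × ℤ)] [cite: GrimmettPercolation1999, §1.5 (1.19), §1.4 p. 13]
[cite: AntunovicVeselic2007, Thm. 2 and §2]
-/

noncomputable section

namespace Summit.CriticalPhenomena.PercolationContinuityZ3.Theorems.Transplant

namespace Grigorchuk

namespace SlabSuscept

open SimpleGraph MeasureTheory Filter Literature.Barriers.CriticalPhenomena Literature.Probability.Percolation
open scoped Classical ENNReal Topology

/-! ## §1 The four interface inequalities of the stacked slab `S = 𝔊 × [0, 2L+1] = S₁ ∪ S₂`, `S₁ = 𝔊 × [0, L]`, `S₂ = 𝔊 × [L+1, 2L+1]`, root `o = (1, 0)` -/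

section Doubling

/-- The root `o = (1, 0)` does not lie in the upper half `𝔊 × [L+1, 2L+1]`. [folklore] -/
theorem root_notMem_upper (L : ℕ) : (((1 : ↥grigorchukGroup), Multiplicative.ofAdd (0 : ℤ)) : GZ) ∉ slabSet ((L : ℤ) + 1) L := by
  simp only [slabSet, Set.mem_setOf_eq, Set.mem_Icc, toAdd_ofAdd]; omega

/-- The top layer of `𝔊 × [0, L]`. [folklore] -/
theorem mk_top_mem_lower (L : ℕ) (g : ↥grigorchukGroup) : ((g, Multiplicative.ofAdd (L : ℤ)) : GZ) ∈ slabSet 0 L := by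
  have h := mem_slabSet_top 0 L g; rwa [zero_add] at h

/-- A series all of whose terms are connections INTO a set from outside vanishes. [folklore] -/
theorem tsum_openConnIn_eq_zero_of_notMem (p : unitInterval) {α : Type} (W : Set GZ) (f : α → GZ) {o : GZ} (ho : o ∉ W) :
    ∑' a, bondPercolation gzCay p (openConnIn W (f a) o) = 0 := by
  simp only [DCTQ.openConnIn_eq_empty_of_notMem ho, measure_empty, tsum_zero]

/-- **(D4) the upper interface mass is fed by the lower one**: `M₂ ≤ p·R·M₁`, where `M₁ = Σ'_g P(o ↔ (g, L) in S)`, `M₂ = Σ'_g P(o ↔ (g, L+1) in S)` are the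
expected numbers of vertices of the two interface layers in the `S`-cluster of the root `o = (1,0)` and `R = Σ'_{g'} P(o ↔ (g', 0) in S₁)` is the same-face
mass of the `L`-slab (window lemma from each target `(g, L+1)` with window `S₂`: the only exits of `S₂` inside `S` are the downward edges of its bottom layer;
the start sums over that layer equal `R` by left-invariance + the vertical shift). `p = p_c(Cay(𝔊 × ℤ))`. [cite: DuminilCopinTassionCMP2016, Lemma 1.5] -/
theorem interface_upper_le (L : ℕ) :
    ∑' g : ↥grigorchukGroup, bondPercolation gzCay (criticalProbIOf gzCay (((1 : ↥grigorchukGroup), Multiplicative.ofAdd (0 : ℤ)) : GZ))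
        (openConnIn (slabSet 0 (2 * L + 1)) (((1 : ↥grigorchukGroup), Multiplicative.ofAdd (0 : ℤ)) : GZ) ((g, Multiplicative.ofAdd ((L : ℤ) + 1)) : GZ)) ≤
      ENNReal.ofReal (criticalProbIOf gzCay (((1 : ↥grigorchukGroup), Multiplicative.ofAdd (0 : ℤ)) : GZ) : ℝ) *
        (∑' g' : ↥grigorchukGroup, bondPercolation gzCay (criticalProbIOf gzCay (((1 : ↥grigorchukGroup), Multiplicative.ofAdd (0 : ℤ)) : GZ))
          (openConnIn (slabSet 0 L) (((1 : ↥grigorchukGroup), Multiplicative.ofAdd (0 : ℤ)) : GZ) ((g', Multiplicative.ofAdd (0 : ℤ)) : GZ))) *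
        ∑' g : ↥grigorchukGroup, bondPercolation gzCay (criticalProbIOf gzCay (((1 : ↥grigorchukGroup), Multiplicative.ofAdd (0 : ℤ)) : GZ))
          (openConnIn (slabSet 0 (2 * L + 1)) (((1 : ↥grigorchukGroup), Multiplicative.ofAdd (0 : ℤ)) : GZ) ((g, Multiplicative.ofAdd (L : ℤ)) : GZ)) := by
  set o : GZ := ((1 : ↥grigorchukGroup), Multiplicative.ofAdd (0 : ℤ)) with ho
  set p := criticalProbIOf gzCay o with hp
  set μ := bondPercolation gzCay p with hμ
  set S := slabSet 0 (2 * L + 1) with hS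
  set W := slabSet ((L : ℤ) + 1) L with hW
  set ι : ↥grigorchukGroup → GZ := fun g => ((g, Multiplicative.ofAdd ((L : ℤ) + 1)) : GZ) with hι
  have hιW : ∀ g, ι g ∈ W := fun g => mem_slabSet_bot ((L : ℤ) + 1) L g
  have hfin : ∀ g, ∑' x : W, μ (openConnIn W (ι g) x) ≠ ⊤ := fun g => by
    rw [← expClusterSize_induce_eq_tsum_openConnIn W p (ι g) (hιW g), hp, criticalProbIOf_gzCay_eq o (ι g)]
    exact slabSusceptFinite _ _ _ (hιW g)
  -- the window lemma from each target, summed over the layer `L+1`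
  have hWin := tsum_measure_openConnIn_le_window_add_exits p W S ι hιW o hfin
  rw [tsum_openConnIn_eq_zero_of_notMem p W ι (root_notMem_upper L), zero_add] at hWin
  -- the exit series: start weight `= R` on the layer `L+1`, exits downward only
  have hexits := tsum_mul_exitSum_le p W S o zP⁻¹ ((L : ℤ) + 1) _ (fun x => ∑' g, μ (openConnIn W (ι g) x))
    (fun x hx => tsum_openConnIn_eq_zero_of_notMem p W ι hx) (fun g => le_of_eq (by
      show (∑' g', μ (openConnIn W ((g', Multiplicative.ofAdd ((L : ℤ) + 1)) : GZ) ((g, Multiplicative.ofAdd ((L : ℤ) + 1)) : GZ))) = _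
      rw [tsum_congr fun g' => measure_openConnIn_comm p W _ _, tsum_layer_leftMul p ((L : ℤ) + 1) L g hιW hιW, tsum_botLayer_shift]))
    (fun x hx => exitSum_upper_le p L o hx)
  -- reindex the downward neighbours of the layer `L+1` as the layer `L`, and flip start/target
  have hre : (∑' g : ↥grigorchukGroup, μ (openConnIn S (((g, Multiplicative.ofAdd ((L : ℤ) + 1)) : GZ) * zP⁻¹) o)) =
      ∑' g : ↥grigorchukGroup, μ (openConnIn S o ((g, Multiplicative.ofAdd (L : ℤ)) : GZ)) :=
    tsum_congr fun g => by rw [mk_mul_zP_inv, add_sub_cancel_right, measure_openConnIn_comm]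
  calc ∑' g, μ (openConnIn S o (ι g)) = ∑' g, μ (openConnIn S (ι g) o) := tsum_congr fun g => measure_openConnIn_comm p S o (ι g)
    _ ≤ _ := hWin
    _ ≤ _ := by rw [mul_assoc]; exact mul_le_mul' le_rfl (hexits.trans (by rw [hre]))

/-- **(D3) the lower interface mass**: `M₁ ≤ T + p·R·M₂`, `T = Σ'_{g'} P(o ↔ (g', L) in S₁)` the through mass of the `L`-slab (window lemma from each target
`(g, L)` with window `S₁`: staying inside `S₁` gives `T`; the only exits of `S₁` inside `S` are the upward edges of its top layer, whose start sums equal `R` by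
left-invariance + the top/bottom reflection). [cite: DuminilCopinTassionCMP2016, Lemma 1.5] -/
theorem interface_lower_le (L : ℕ) :
    ∑' g : ↥grigorchukGroup, bondPercolation gzCay (criticalProbIOf gzCay (((1 : ↥grigorchukGroup), Multiplicative.ofAdd (0 : ℤ)) : GZ))
        (openConnIn (slabSet 0 (2 * L + 1)) (((1 : ↥grigorchukGroup), Multiplicative.ofAdd (0 : ℤ)) : GZ) ((g, Multiplicative.ofAdd (L : ℤ)) : GZ)) ≤
      (∑' g' : ↥grigorchukGroup, bondPercolation gzCay (criticalProbIOf gzCay (((1 : ↥grigorchukGroup), Multiplicative.ofAdd (0 : ℤ)) : GZ))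
          (openConnIn (slabSet 0 L) (((1 : ↥grigorchukGroup), Multiplicative.ofAdd (0 : ℤ)) : GZ) ((g', Multiplicative.ofAdd (L : ℤ)) : GZ))) +
      ENNReal.ofReal (criticalProbIOf gzCay (((1 : ↥grigorchukGroup), Multiplicative.ofAdd (0 : ℤ)) : GZ) : ℝ) *
        (∑' g' : ↥grigorchukGroup, bondPercolation gzCay (criticalProbIOf gzCay (((1 : ↥grigorchukGroup), Multiplicative.ofAdd (0 : ℤ)) : GZ))
          (openConnIn (slabSet 0 L) (((1 : ↥grigorchukGroup), Multiplicative.ofAdd (0 : ℤ)) : GZ) ((g', Multiplicative.ofAdd (0 : ℤ)) : GZ))) *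
        ∑' g : ↥grigorchukGroup, bondPercolation gzCay (criticalProbIOf gzCay (((1 : ↥grigorchukGroup), Multiplicative.ofAdd (0 : ℤ)) : GZ))
          (openConnIn (slabSet 0 (2 * L + 1)) (((1 : ↥grigorchukGroup), Multiplicative.ofAdd (0 : ℤ)) : GZ) ((g, Multiplicative.ofAdd ((L : ℤ) + 1)) : GZ)) := by
  set o : GZ := ((1 : ↥grigorchukGroup), Multiplicative.ofAdd (0 : ℤ)) with ho
  set p := criticalProbIOf gzCay o with hp
  set μ := bondPercolation gzCay p with hμ
  set S := slabSet 0 (2 * L + 1) with hS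
  set W := slabSet 0 L with hW
  set ι : ↥grigorchukGroup → GZ := fun g => ((g, Multiplicative.ofAdd (L : ℤ)) : GZ) with hι
  have hιW : ∀ g, ι g ∈ W := fun g => mk_top_mem_lower L g
  have hfin : ∀ g, ∑' x : W, μ (openConnIn W (ι g) x) ≠ ⊤ := fun g => by
    rw [← expClusterSize_induce_eq_tsum_openConnIn W p (ι g) (hιW g), hp, criticalProbIOf_gzCay_eq o (ι g)]
    exact slabSusceptFinite _ _ _ (hιW g)
  have hWin := tsum_measure_openConnIn_le_window_add_exits p W S ι hιW o hfin
  have hfirst : (∑' g, μ (openConnIn W (ι g) o)) = ∑' g, μ (openConnIn W o (ι g)) := tsum_congr fun g => measure_openConnIn_comm p W (ι g) o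
  have hexits := tsum_mul_exitSum_le p W S o zP (L : ℤ) _ (fun x => ∑' g, μ (openConnIn W (ι g) x))
    (fun x hx => tsum_openConnIn_eq_zero_of_notMem p W ι hx) (fun g => le_of_eq (by
      show (∑' g', μ (openConnIn W ((g', Multiplicative.ofAdd (L : ℤ)) : GZ) ((g, Multiplicative.ofAdd (L : ℤ)) : GZ))) = _
      rw [tsum_congr fun g' => measure_openConnIn_comm p W _ _, tsum_layer_leftMul p 0 L g hιW hιW, tsum_topLayer_eq_botLayer]))
    (fun x hx => exitSum_lower_le p L o hx)
  have hre : (∑' g : ↥grigorchukGroup, μ (openConnIn S (((g, Multiplicative.ofAdd (L : ℤ)) : GZ) * zP) o)) =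
      ∑' g : ↥grigorchukGroup, μ (openConnIn S o ((g, Multiplicative.ofAdd ((L : ℤ) + 1)) : GZ)) :=
    tsum_congr fun g => by rw [mk_mul_zP, measure_openConnIn_comm]
  calc ∑' g, μ (openConnIn S o (ι g)) = ∑' g, μ (openConnIn S (ι g) o) := tsum_congr fun g => measure_openConnIn_comm p S o (ι g)
    _ ≤ _ := hWin
    _ ≤ _ := by rw [hfirst, mul_assoc]; exact add_le_add le_rfl (mul_le_mul' le_rfl (hexits.trans (by rw [hre])))

/-- **(D1) the mass of the root's `S`-cluster in the UPPER half**: `Σ'_{v ∈ S₂} P(o ↔ v in S) ≤ p·F(L)·M₁`, `F(L) = E|C^{S₁}(o)|` (window lemma from each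
target `v ∈ S₂` with window `S₂`; the start sums at the bottom layer of `S₂` are the boundary-root susceptibility of an `L`-slab, `boundary_eq_canonical`).
[cite: DuminilCopinTassionCMP2016, Lemma 1.5] -/
theorem upperHalf_mass_le (L : ℕ) :
    ∑' v : slabSet ((L : ℤ) + 1) L, bondPercolation gzCay (criticalProbIOf gzCay (((1 : ↥grigorchukGroup), Multiplicative.ofAdd (0 : ℤ)) : GZ))
        (openConnIn (slabSet 0 (2 * L + 1)) (((1 : ↥grigorchukGroup), Multiplicative.ofAdd (0 : ℤ)) : GZ) (v : GZ)) ≤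
      ENNReal.ofReal (criticalProbIOf gzCay (((1 : ↥grigorchukGroup), Multiplicative.ofAdd (0 : ℤ)) : GZ) : ℝ) *
        expClusterSize (gzCay.induce (slabSet 0 L)) ⟨((1 : ↥grigorchukGroup), Multiplicative.ofAdd 0), mem_slabSet_bot 0 L 1⟩
          (criticalProbIOf gzCay (((1 : ↥grigorchukGroup), Multiplicative.ofAdd (0 : ℤ)) : GZ)) *
        ∑' g : ↥grigorchukGroup, bondPercolation gzCay (criticalProbIOf gzCay (((1 : ↥grigorchukGroup), Multiplicative.ofAdd (0 : ℤ)) : GZ))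
          (openConnIn (slabSet 0 (2 * L + 1)) (((1 : ↥grigorchukGroup), Multiplicative.ofAdd (0 : ℤ)) : GZ) ((g, Multiplicative.ofAdd (L : ℤ)) : GZ)) := by
  set o : GZ := ((1 : ↥grigorchukGroup), Multiplicative.ofAdd (0 : ℤ)) with ho
  set p := criticalProbIOf gzCay o with hp
  set μ := bondPercolation gzCay p with hμ
  set S := slabSet 0 (2 * L + 1) with hS
  set W := slabSet ((L : ℤ) + 1) L with hW
  set ι : W → GZ := fun v => (v : GZ) with hι
  have hιW : ∀ v, ι v ∈ W := fun v => v.2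
  have hfin : ∀ v, ∑' x : W, μ (openConnIn W (ι v) x) ≠ ⊤ := fun v => by
    rw [← expClusterSize_induce_eq_tsum_openConnIn W p (ι v) (hιW v), hp, criticalProbIOf_gzCay_eq o (ι v)]
    exact slabSusceptFinite _ _ _ (hιW v)
  have hWin := tsum_measure_openConnIn_le_window_add_exits p W S ι hιW o hfin
  rw [tsum_openConnIn_eq_zero_of_notMem p W ι (root_notMem_upper L), zero_add] at hWin
  have hexits := tsum_mul_exitSum_le p W S o zP⁻¹ ((L : ℤ) + 1)
    (expClusterSize (gzCay.induce (slabSet 0 L)) ⟨((1 : ↥grigorchukGroup), Multiplicative.ofAdd 0), mem_slabSet_bot 0 L 1⟩ p)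
    (fun x => ∑' v, μ (openConnIn W (ι v) x))
    (fun x hx => tsum_openConnIn_eq_zero_of_notMem p W ι hx)
    (fun g => le_of_eq ((tsum_openConnIn_start_eq_expClusterSize p W _ (mem_slabSet_bot ((L : ℤ) + 1) L g)).trans
      (boundary_eq_canonical ((L : ℤ) + 1) L g p)))
    (fun x hx => exitSum_upper_le p L o hx)
  have hre : (∑' g : ↥grigorchukGroup, μ (openConnIn S (((g, Multiplicative.ofAdd ((L : ℤ) + 1)) : GZ) * zP⁻¹) o)) =
      ∑' g : ↥grigorchukGroup, μ (openConnIn S o ((g, Multiplicative.ofAdd (L : ℤ)) : GZ)) :=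
    tsum_congr fun g => by rw [mk_mul_zP_inv, add_sub_cancel_right, measure_openConnIn_comm]
  calc ∑' v : W, μ (openConnIn S o (v : GZ)) = ∑' v : W, μ (openConnIn S (ι v) o) := tsum_congr fun v => measure_openConnIn_comm p S o v
    _ ≤ _ := hWin
    _ ≤ _ := by rw [mul_assoc]; exact mul_le_mul' le_rfl (hexits.trans (by rw [hre]))

/-- **(D2) the mass of the root's `S`-cluster in the LOWER half**: `Σ'_{v ∈ S₁} P(o ↔ v in S) ≤ F(L) + p·F(L)·M₂` (window `S₁` from each target `v ∈ S₁`: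
staying inside gives `E|C^{S₁}(o)| = F(L)`; the start sums at the top layer of `S₁` equal `F(L)` by `top_eq_canonical`). [cite: DuminilCopinTassionCMP2016, Lemma 1.5] -/
theorem lowerHalf_mass_le (L : ℕ) :
    ∑' v : slabSet 0 L, bondPercolation gzCay (criticalProbIOf gzCay (((1 : ↥grigorchukGroup), Multiplicative.ofAdd (0 : ℤ)) : GZ))
        (openConnIn (slabSet 0 (2 * L + 1)) (((1 : ↥grigorchukGroup), Multiplicative.ofAdd (0 : ℤ)) : GZ) (v : GZ)) ≤
      expClusterSize (gzCay.induce (slabSet 0 L)) ⟨((1 : ↥grigorchukGroup), Multiplicative.ofAdd 0), mem_slabSet_bot 0 L 1⟩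
          (criticalProbIOf gzCay (((1 : ↥grigorchukGroup), Multiplicative.ofAdd (0 : ℤ)) : GZ)) +
      ENNReal.ofReal (criticalProbIOf gzCay (((1 : ↥grigorchukGroup), Multiplicative.ofAdd (0 : ℤ)) : GZ) : ℝ) *
        expClusterSize (gzCay.induce (slabSet 0 L)) ⟨((1 : ↥grigorchukGroup), Multiplicative.ofAdd 0), mem_slabSet_bot 0 L 1⟩
          (criticalProbIOf gzCay (((1 : ↥grigorchukGroup), Multiplicative.ofAdd (0 : ℤ)) : GZ)) *
        ∑' g : ↥grigorchukGroup, bondPercolation gzCay (criticalProbIOf gzCay (((1 : ↥grigorchukGroup), Multiplicative.ofAdd (0 : ℤ)) : GZ))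
          (openConnIn (slabSet 0 (2 * L + 1)) (((1 : ↥grigorchukGroup), Multiplicative.ofAdd (0 : ℤ)) : GZ) ((g, Multiplicative.ofAdd ((L : ℤ) + 1)) : GZ)) := by
  set o : GZ := ((1 : ↥grigorchukGroup), Multiplicative.ofAdd (0 : ℤ)) with ho
  set p := criticalProbIOf gzCay o with hp
  set μ := bondPercolation gzCay p with hμ
  set S := slabSet 0 (2 * L + 1) with hS
  set W := slabSet 0 L with hW
  set ι : W → GZ := fun v => (v : GZ) with hι
  have hιW : ∀ v, ι v ∈ W := fun v => v.2
  have hfin : ∀ v, ∑' x : W, μ (openConnIn W (ι v) x) ≠ ⊤ := fun v => by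
    rw [← expClusterSize_induce_eq_tsum_openConnIn W p (ι v) (hιW v), hp, criticalProbIOf_gzCay_eq o (ι v)]
    exact slabSusceptFinite _ _ _ (hιW v)
  have hWin := tsum_measure_openConnIn_le_window_add_exits p W S ι hιW o hfin
  rw [tsum_openConnIn_start_eq_expClusterSize p W o (mem_slabSet_bot 0 L 1)] at hWin
  have hexits := tsum_mul_exitSum_le p W S o zP (L : ℤ)
    (expClusterSize (gzCay.induce (slabSet 0 L)) ⟨((1 : ↥grigorchukGroup), Multiplicative.ofAdd 0), mem_slabSet_bot 0 L 1⟩ p)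
    (fun x => ∑' v, μ (openConnIn W (ι v) x))
    (fun x hx => tsum_openConnIn_eq_zero_of_notMem p W ι hx)
    (fun g => le_of_eq (((tsum_openConnIn_start_eq_expClusterSize p W _ (mk_top_mem_lower L g)).trans
      (expClusterSize_slab_congr rfl rfl (mk_top_mem_lower L g) (mem_slabSet_top 0 L g) p (Prod.ext rfl (by rw [zero_add])))).trans
      (top_eq_canonical 0 L g p)))
    (fun x hx => exitSum_lower_le p L o hx)
  have hre : (∑' g : ↥grigorchukGroup, μ (openConnIn S (((g, Multiplicative.ofAdd (L : ℤ)) : GZ) * zP) o)) =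
      ∑' g : ↥grigorchukGroup, μ (openConnIn S o ((g, Multiplicative.ofAdd ((L : ℤ) + 1)) : GZ)) :=
    tsum_congr fun g => by rw [mk_mul_zP, measure_openConnIn_comm]
  calc ∑' v : W, μ (openConnIn S o (v : GZ)) = ∑' v : W, μ (openConnIn S (ι v) o) := tsum_congr fun v => measure_openConnIn_comm p S o v
    _ ≤ _ := hWin
    _ ≤ _ := by rw [mul_assoc]; exact add_le_add le_rfl (mul_le_mul' le_rfl (hexits.trans (by rw [hre])))

/-! ## §2 The division-free interface algebra (w-idea-2 g7, Sketch-CARD-7 7adc5d7e §2b, PROVED there — copied with attribution) and the doubling inequality -/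

/-- `(1 − r)(1 + r) = 1 − r²` in `ℝ≥0∞` (`r ≠ ⊤`). (w-idea-2 g7, Sketch-CARD-7 §2b.) [folklore] -/
theorem one_sub_mul_one_add {r : ℝ≥0∞} (hr1 : r ≠ ⊤) : (1 - r) * (1 + r) = 1 - r * r := by
  rw [ENNReal.sub_mul (fun _ _ => ENNReal.add_ne_top.2 ⟨ENNReal.one_ne_top, hr1⟩), one_mul, mul_add, mul_one,
    ← tsub_tsub, ENNReal.add_sub_cancel_right hr1]

/-- `x ≤ G + c·x`, `x ≠ ⊤` ⇒ `(1 − c)·x ≤ G` (truncated subtraction). (w-idea-2 g7, Sketch-CARD-7 §2b.) [folklore] -/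
theorem one_sub_mul_le_of_le_add {x G c : ℝ≥0∞} (hx : x ≠ ⊤) (h : x ≤ G + c * x) : (1 - c) * x ≤ G := by
  rw [ENNReal.sub_mul (fun _ _ => hx), one_mul]
  exact tsub_le_iff_right.2 h

/-- **The 2×2 interface solve, division-free** (w-idea-2 g7, Sketch-CARD-7 §2b, verbatim): `a ≤ G + r b`, `b ≤ r a`, `a ≠ ⊤` ⇒ `(1 − r)(a + b) ≤ G` — trivially when
`r ≥ 1` (the left factor is `0`), else by `(1 − r²) a ≤ G`. [folklore] -/
theorem interface_solve {a b G r : ℝ≥0∞} (ha : a ≠ ⊤) (h1 : a ≤ G + r * b) (h2 : b ≤ r * a) :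
    (1 - r) * (a + b) ≤ G := by
  rcases le_or_gt 1 r with hr | hr
  · rw [tsub_eq_zero_of_le hr, zero_mul]; exact bot_le
  have hr1 : r ≠ ⊤ := ne_top_of_lt hr
  have e1 : (1 - r) * (a + r * a) = (1 - r * r) * a := by
    rw [show a + r * a = (1 + r) * a by rw [add_mul, one_mul], ← mul_assoc, one_sub_mul_one_add hr1]
  have step1 : (1 - r) * (a + b) ≤ (1 - r * r) * a := by
    rw [← e1]; exact mul_le_mul' le_rfl (add_le_add le_rfl h2)
  have h3 : a ≤ G + r * r * a := h1.trans (add_le_add le_rfl (by rw [mul_assoc]; exact mul_le_mul' le_rfl h2))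
  exact step1.trans (one_sub_mul_le_of_le_add ha h3)

/-- **THE DOUBLING INEQUALITY, internal currency** (ambient `openConnIn` series at `p_c`): with `S = 𝔊 × [0, 2L+1]`, `S₁ = 𝔊 × [0, L]`, `o = (1, 0)`,
`F = E|C^{S₁}(o)|`, `R = Σ'_{g'} P(o ↔ (g', 0) in S₁)`, `T = Σ'_{g'} P(o ↔ (g', L) in S₁)`:
`(1 − p·R) · E|C^S(o)| ≤ (1 − p·R + p·T) · F` — from (D1)–(D4), `E|C^S(o)| ≤ mass(S₁) + mass(S₂)` and `interface_solve` (M₁ < ∞ by T7); trivial when `p·R ≥ 1`.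
[cite: DuminilCopinTassionCMP2016, Lemma 1.5] [cite: BenjaminiSchramm1996, §2 (Cayley graphs; 𝔊 × ℤ)] -/
theorem doubling_le_openConnIn (L : ℕ) :
    (1 - ENNReal.ofReal (criticalProbIOf gzCay (((1 : ↥grigorchukGroup), Multiplicative.ofAdd (0 : ℤ)) : GZ) : ℝ) *
        ∑' g' : ↥grigorchukGroup, bondPercolation gzCay (criticalProbIOf gzCay (((1 : ↥grigorchukGroup), Multiplicative.ofAdd (0 : ℤ)) : GZ))
          (openConnIn (slabSet 0 L) (((1 : ↥grigorchukGroup), Multiplicative.ofAdd (0 : ℤ)) : GZ) ((g', Multiplicative.ofAdd (0 : ℤ)) : GZ))) *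
      expClusterSize (gzCay.induce (slabSet 0 (2 * L + 1))) ⟨((1 : ↥grigorchukGroup), Multiplicative.ofAdd 0), mem_slabSet_bot 0 (2 * L + 1) 1⟩
        (criticalProbIOf gzCay (((1 : ↥grigorchukGroup), Multiplicative.ofAdd (0 : ℤ)) : GZ)) ≤
    (1 - ENNReal.ofReal (criticalProbIOf gzCay (((1 : ↥grigorchukGroup), Multiplicative.ofAdd (0 : ℤ)) : GZ) : ℝ) *
        ∑' g' : ↥grigorchukGroup, bondPercolation gzCay (criticalProbIOf gzCay (((1 : ↥grigorchukGroup), Multiplicative.ofAdd (0 : ℤ)) : GZ))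
          (openConnIn (slabSet 0 L) (((1 : ↥grigorchukGroup), Multiplicative.ofAdd (0 : ℤ)) : GZ) ((g', Multiplicative.ofAdd (0 : ℤ)) : GZ)) +
      ENNReal.ofReal (criticalProbIOf gzCay (((1 : ↥grigorchukGroup), Multiplicative.ofAdd (0 : ℤ)) : GZ) : ℝ) *
        ∑' g' : ↥grigorchukGroup, bondPercolation gzCay (criticalProbIOf gzCay (((1 : ↥grigorchukGroup), Multiplicative.ofAdd (0 : ℤ)) : GZ))
          (openConnIn (slabSet 0 L) (((1 : ↥grigorchukGroup), Multiplicative.ofAdd (0 : ℤ)) : GZ) ((g', Multiplicative.ofAdd (L : ℤ)) : GZ))) *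
      expClusterSize (gzCay.induce (slabSet 0 L)) ⟨((1 : ↥grigorchukGroup), Multiplicative.ofAdd 0), mem_slabSet_bot 0 L 1⟩
        (criticalProbIOf gzCay (((1 : ↥grigorchukGroup), Multiplicative.ofAdd (0 : ℤ)) : GZ)) := by
  set o : GZ := ((1 : ↥grigorchukGroup), Multiplicative.ofAdd (0 : ℤ)) with ho
  set p := criticalProbIOf gzCay o with hp
  set μ := bondPercolation gzCay p with hμ
  set pp := ENNReal.ofReal (p : ℝ) with hpp
  set S := slabSet 0 (2 * L + 1) with hS
  set S₁ := slabSet 0 L with hS₁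
  set S₂ := slabSet ((L : ℤ) + 1) L with hS₂
  set F := expClusterSize (gzCay.induce S₁) ⟨o, mem_slabSet_bot 0 L 1⟩ p with hF
  set X := expClusterSize (gzCay.induce S) ⟨o, mem_slabSet_bot 0 (2 * L + 1) 1⟩ p with hX
  set R := ∑' g' : ↥grigorchukGroup, μ (openConnIn S₁ o ((g', Multiplicative.ofAdd (0 : ℤ)) : GZ)) with hR
  set T := ∑' g' : ↥grigorchukGroup, μ (openConnIn S₁ o ((g', Multiplicative.ofAdd (L : ℤ)) : GZ)) with hT
  set M₁ := ∑' g : ↥grigorchukGroup, μ (openConnIn S o ((g, Multiplicative.ofAdd (L : ℤ)) : GZ)) with hM₁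
  set M₂ := ∑' g : ↥grigorchukGroup, μ (openConnIn S o ((g, Multiplicative.ofAdd ((L : ℤ) + 1)) : GZ)) with hM₂
  set m₁ := ∑' v : S₁, μ (openConnIn S o (v : GZ)) with hm₁
  set m₂ := ∑' v : S₂, μ (openConnIn S o (v : GZ)) with hm₂
  change (1 - pp * R) * X ≤ (1 - pp * R + pp * T) * F
  have hD1 : m₂ ≤ pp * F * M₁ := upperHalf_mass_le L
  have hD2 : m₁ ≤ F + pp * F * M₂ := lowerHalf_mass_le L
  have hD3 : M₁ ≤ T + pp * R * M₂ := interface_lower_le L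
  have hD4 : M₂ ≤ pp * R * M₁ := interface_upper_le L
  -- `X ≤ m₁ + m₂` (`S ⊆ S₁ ∪ S₂`) and `M₁ ≤ X < ∞` (T7)
  have hXtop : X ≠ ⊤ := slabSusceptFinite 0 (2 * L + 1) o (mem_slabSet_bot 0 (2 * L + 1) 1)
  have hXsum : X = ∑' y : S, μ (openConnIn S o y) := expClusterSize_induce_eq_tsum_openConnIn S p o (mem_slabSet_bot 0 (2 * L + 1) 1)
  have hX : X ≤ m₁ + m₂ := by
    have hsub : S ⊆ S₁ ∪ S₂ := fun y hy => by
      simp only [hS, hS₁, hS₂, slabSet, Set.mem_setOf_eq, Set.mem_Icc, Set.mem_union] at hy ⊢; push_cast at hy ⊢; omega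
    rw [hXsum]
    exact (ENNReal.tsum_mono_subtype (fun y => μ (openConnIn S o y)) hsub).trans (ENNReal.tsum_union_le (fun y => μ (openConnIn S o y)) S₁ S₂)
  have hM₁top : M₁ ≠ ⊤ := by
    refine ne_top_of_le_ne_top hXtop ?_
    rw [hXsum]
    have hmemL : ∀ g : ↥grigorchukGroup, ((g, Multiplicative.ofAdd (L : ℤ)) : GZ) ∈ S := fun g => by
      simp only [hS, slabSet, Set.mem_setOf_eq, Set.mem_Icc, toAdd_ofAdd]; push_cast; omega
    have hinj : Function.Injective (fun g : ↥grigorchukGroup => (⟨((g, Multiplicative.ofAdd (L : ℤ)) : GZ), hmemL g⟩ : S)) :=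
      fun a b e => (Prod.ext_iff.1 (Subtype.ext_iff.1 e)).1
    exact ENNReal.tsum_comp_le_tsum_of_injective hinj (fun y : S => μ (openConnIn S o y))
  -- the algebra
  have hsolve : (1 - pp * R) * (M₁ + M₂) ≤ T := interface_solve hM₁top hD3 hD4
  have hm : m₁ + m₂ ≤ F + pp * F * (M₁ + M₂) := by
    calc m₁ + m₂ ≤ F + pp * F * M₂ + pp * F * M₁ := add_le_add hD2 hD1
      _ = F + pp * F * (M₁ + M₂) := by rw [mul_add, add_assoc, add_comm (pp * F * M₂)]
  calc (1 - pp * R) * X ≤ (1 - pp * R) * (F + pp * F * (M₁ + M₂)) := mul_le_mul' le_rfl (hX.trans hm)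
    _ = (1 - pp * R) * F + pp * F * ((1 - pp * R) * (M₁ + M₂)) := by rw [mul_add, mul_left_comm]
    _ ≤ (1 - pp * R) * F + pp * F * T := add_le_add le_rfl (mul_le_mul' le_rfl hsolve)
    _ = (1 - pp * R + pp * T) * F := by rw [add_mul]; congr 1; rw [mul_assoc, mul_comm F T, ← mul_assoc]

/-- **THE DOUBLING INEQUALITY (CARD-7's first lemma `doubling_le`, KERNEL)** in the card's own currency — the two boundary-layer masses are VERBATIM the two
series of F3's `layer_flux_ge 0 L 0` (`R(L)` = same-face mass of the boundary root `(1,0)` of `𝔊 × [0, L]`, `T(L)` = through mass from the top root `(1, L)` to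
the bottom layer), `F(L) = E|C^{𝔊 × [0,L]}((1,0))|`, `p = p_c(Cay(𝔊 × ℤ))` read at `(1,0)`:
`(1 − p·R(L)) · F(2L+1) ≤ (1 − p·R(L) + p·T(L)) · F(L)`  (truncated subtraction: trivially `0 ≤ …` when `p·R(L) ≥ 1`).
Equivalently `F(2L+1) ≤ F(L)·(1 + Θ(L))`, `Θ = p·T/(1 − p·R)`, whenever `p·R(L) < 1`.  Mean field: an identity.  This is a REDUCTION step on the W2 height axis
(critic V7-1: its useful regime `p·R(L) < 1` is the near-tightness of the flux floor at boundary roots, located-negative on every lattice control — VERDICTS :568);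
it decides nothing about FLUX(W2), K3′, K3″ or `θ(p_c)`; `gzCay_conj4` OPEN. [cite: DuminilCopinTassionCMP2016, Lemma 1.5] [cite: BenjaminiSchramm1996, §2 (Cayley graphs; 𝔊 × ℤ)] -/
theorem doubling_le (L : ℕ) :
    (1 - ENNReal.ofReal (criticalProbIOf gzCay (((1 : ↥grigorchukGroup), Multiplicative.ofAdd (0 : ℤ)) : GZ) : ℝ) *
        ∑' g' : ↥grigorchukGroup, bondPercolation (gzCay.induce (slabSet 0 L)) (criticalProbIOf gzCay (((1 : ↥grigorchukGroup), Multiplicative.ofAdd (0 : ℤ)) : GZ))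
          (openConn (⟨((1 : ↥grigorchukGroup), Multiplicative.ofAdd (0 : ℤ)), mem_slabSet_bot 0 L 1⟩ : slabSet 0 L)
            ⟨(g', Multiplicative.ofAdd ((0 : ℤ) + ((0 : ℕ) : ℤ))), mem_slabSet_of_le 0 (Nat.zero_le L) g'⟩)) *
      expClusterSize (gzCay.induce (slabSet 0 (2 * L + 1))) ⟨((1 : ↥grigorchukGroup), Multiplicative.ofAdd 0), mem_slabSet_bot 0 (2 * L + 1) 1⟩
        (criticalProbIOf gzCay (((1 : ↥grigorchukGroup), Multiplicative.ofAdd (0 : ℤ)) : GZ)) ≤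
    (1 - ENNReal.ofReal (criticalProbIOf gzCay (((1 : ↥grigorchukGroup), Multiplicative.ofAdd (0 : ℤ)) : GZ) : ℝ) *
        ∑' g' : ↥grigorchukGroup, bondPercolation (gzCay.induce (slabSet 0 L)) (criticalProbIOf gzCay (((1 : ↥grigorchukGroup), Multiplicative.ofAdd (0 : ℤ)) : GZ))
          (openConn (⟨((1 : ↥grigorchukGroup), Multiplicative.ofAdd (0 : ℤ)), mem_slabSet_bot 0 L 1⟩ : slabSet 0 L)
            ⟨(g', Multiplicative.ofAdd ((0 : ℤ) + ((0 : ℕ) : ℤ))), mem_slabSet_of_le 0 (Nat.zero_le L) g'⟩) +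
      ENNReal.ofReal (criticalProbIOf gzCay (((1 : ↥grigorchukGroup), Multiplicative.ofAdd (0 : ℤ)) : GZ) : ℝ) *
        ∑' g' : ↥grigorchukGroup, bondPercolation (gzCay.induce (slabSet 0 L)) (criticalProbIOf gzCay (((1 : ↥grigorchukGroup), Multiplicative.ofAdd (0 : ℤ)) : GZ))
          (openConn (⟨((1 : ↥grigorchukGroup), Multiplicative.ofAdd ((0 : ℤ) + (L : ℤ))), mem_slabSet_top 0 L 1⟩ : slabSet 0 L)
            ⟨(g', Multiplicative.ofAdd ((0 : ℤ) + ((0 : ℕ) : ℤ))), mem_slabSet_of_le 0 (Nat.zero_le L) g'⟩)) *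
      expClusterSize (gzCay.induce (slabSet 0 L)) ⟨((1 : ↥grigorchukGroup), Multiplicative.ofAdd 0), mem_slabSet_bot 0 L 1⟩
        (criticalProbIOf gzCay (((1 : ↥grigorchukGroup), Multiplicative.ofAdd (0 : ℤ)) : GZ)) := by
  set o : GZ := ((1 : ↥grigorchukGroup), Multiplicative.ofAdd (0 : ℤ)) with ho
  set p := criticalProbIOf gzCay o with hp
  haveI : Countable GZ := countable_of_connected_of_locallyFinite gzCay gzCay_connected o
  have hR : (∑' g' : ↥grigorchukGroup, bondPercolation (gzCay.induce (slabSet 0 L)) p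
      (openConn (⟨((1 : ↥grigorchukGroup), Multiplicative.ofAdd (0 : ℤ)), mem_slabSet_bot 0 L 1⟩ : slabSet 0 L)
        ⟨(g', Multiplicative.ofAdd ((0 : ℤ) + ((0 : ℕ) : ℤ))), mem_slabSet_of_le 0 (Nat.zero_le L) g'⟩)) =
      ∑' g' : ↥grigorchukGroup, bondPercolation gzCay p (openConnIn (slabSet 0 L) o ((g', Multiplicative.ofAdd (0 : ℤ)) : GZ)) :=
    tsum_congr fun g' => by rw [measure_openConn_induce_eq]; simp only [Nat.cast_zero, add_zero]; rfl
  have hT : (∑' g' : ↥grigorchukGroup, bondPercolation (gzCay.induce (slabSet 0 L)) p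
      (openConn (⟨((1 : ↥grigorchukGroup), Multiplicative.ofAdd ((0 : ℤ) + (L : ℤ))), mem_slabSet_top 0 L 1⟩ : slabSet 0 L)
        ⟨(g', Multiplicative.ofAdd ((0 : ℤ) + ((0 : ℕ) : ℤ))), mem_slabSet_of_le 0 (Nat.zero_le L) g'⟩)) =
      ∑' g' : ↥grigorchukGroup, bondPercolation gzCay p (openConnIn (slabSet 0 L) o ((g', Multiplicative.ofAdd (L : ℤ)) : GZ)) := by
    rw [tsum_layer_symm 0 L p 1 (h₀ := (0 : ℤ) + ((0 : ℕ) : ℤ)) (h := (0 : ℤ) + (L : ℤ)) (fun g' => mem_slabSet_of_le 0 (Nat.zero_le L) g') (mem_slabSet_top 0 L)]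
    refine tsum_congr fun g' => ?_
    rw [measure_openConn_induce_eq]
    simp only [Nat.cast_zero, add_zero, zero_add]; rfl
  rw [hR, hT]
  exact doubling_le_openConnIn L

/-- **The kernel floor in the same currency** (F3 `layer_flux_ge 0 L 0`, for the record next to `doubling_le`): `1 ≤ p·T(L) + p·R(L)` — so `Θ(L) ≥ 1`
whenever `p·R(L) < 1`; mean field sits ON the floor. [cite: DuminilCopinTassionCMP2016, Thm. 1.1 (φ_p(S))] -/
theorem one_le_flux_boundary (L : ℕ) :
    1 ≤ ENNReal.ofReal (criticalProbIOf gzCay (((1 : ↥grigorchukGroup), Multiplicative.ofAdd (0 : ℤ)) : GZ) : ℝ) *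
        (∑' g' : ↥grigorchukGroup, bondPercolation (gzCay.induce (slabSet 0 L)) (criticalProbIOf gzCay (((1 : ↥grigorchukGroup), Multiplicative.ofAdd (0 : ℤ)) : GZ))
          (openConn (⟨((1 : ↥grigorchukGroup), Multiplicative.ofAdd ((0 : ℤ) + (L : ℤ))), mem_slabSet_top 0 L 1⟩ : slabSet 0 L)
            ⟨(g', Multiplicative.ofAdd ((0 : ℤ) + ((0 : ℕ) : ℤ))), mem_slabSet_of_le 0 (Nat.zero_le L) g'⟩)) +
      ENNReal.ofReal (criticalProbIOf gzCay (((1 : ↥grigorchukGroup), Multiplicative.ofAdd (0 : ℤ)) : GZ) : ℝ) *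
        ∑' g' : ↥grigorchukGroup, bondPercolation (gzCay.induce (slabSet 0 L)) (criticalProbIOf gzCay (((1 : ↥grigorchukGroup), Multiplicative.ofAdd (0 : ℤ)) : GZ))
          (openConn (⟨((1 : ↥grigorchukGroup), Multiplicative.ofAdd (0 : ℤ)), mem_slabSet_bot 0 L 1⟩ : slabSet 0 L)
            ⟨(g', Multiplicative.ofAdd ((0 : ℤ) + ((0 : ℕ) : ℤ))), mem_slabSet_of_le 0 (Nat.zero_le L) g'⟩) := by
  set p := criticalProbIOf gzCay (((1 : ↥grigorchukGroup), Multiplicative.ofAdd (0 : ℤ)) : GZ) with hp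
  have h := layer_flux_ge 0 L 0 (Nat.zero_le L) 1
  have hpos : 0 < (p : ℝ) := criticalProbIOf_gzCay_pos _
  calc (1 : ℝ≥0∞) = ENNReal.ofReal (p : ℝ) * ENNReal.ofReal (1 / (p : ℝ)) := by
        rw [← ENNReal.ofReal_mul hpos.le, mul_one_div_cancel hpos.ne', ENNReal.ofReal_one]
    _ ≤ _ := by rw [← mul_add]; exact mul_le_mul' le_rfl h

end Doubling

end SlabSuscept

end Grigorchuk

end Summit.CriticalPhenomena.PercolationContinuityZ3.Theorems.Transplant

end
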